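import Summits.ResolutionOfSingularities.ResolutionOfSingularities.Theorems.HilbertSamuelEliminationCampaignW42ToricMarkedFan

/-!
# [OURS · L1 W4.2] Toric marked monomial objects in dimension 3 — brick 7E (part 1): star subdivision keeps cones inside their parents and independent

[OURS · L1 W4.2 · seat res-L1-s42-pv-2 gen 5] Memo `L/res-L1-s42-pv-2/CALIBRATION-W42-O2-v4.md` §7 (bridge B2).  Two of the three ingredients of
«the star subdivision of a fan is a fan» in the id/vector model: (B2-a) the cone of a child `(C ∖ x) ∪ {ρ}` (`x ∈ R ⊆ C`, `vec ρ = Σ_R vec`) lies in the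
cone of its parent, with the explicit coefficient change (`inCone_parent_of_inCone_child`); (B2-b) the child's vectors are again linearly independent
(`indep_child`, unimodular base change).  The pair property (cones of two children / a child and an untouched cone meet in the cone of their common
rays — four coefficient computations, memo §7) is part 2.  NOT a statement of the manuscript under review.  AI work, weaker than expert review.
No `sorry`, no new axiom.
-/

set_option linter.dupNamespace false -- mandated namespace of this single-conjunct summit

namespace Summit.ResolutionOfSingularities.ResolutionOfSingularities.Theorems.CampaignW42.Toric

open Finset

namespace VState

open Fan

variable {ι : Type}

/-- The new ray's rational vector is the sum of the face's vectors. -/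
theorem qv_move_next (m : ℕ) (s : VState ι) (R : Finset ℕ) :
    qv (s.move m R).vec s.next = ∑ r ∈ R, qv s.vec r := by
  funext i
  simp only [qv, vec_move_next, Finset.sum_apply]
  push_cast
  rfl

/-- Old rays keep their rational vectors. -/
theorem qv_move_of_ne {m : ℕ} {s : VState ι} {R : Finset ℕ} {r : ℕ} (hr : r ≠ s.next) :
    qv (s.move m R).vec r = qv s.vec r := by
  funext i; simp only [qv, vec_move_of_ne hr]

/-- Sums over a child cone `(C ∖ x) ∪ {ρ}` of old-ray vectors, re-expressed over the old rays. -/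
theorem sum_child_qv {m : ℕ} {s : VState ι} {R C : Finset ℕ} {x : ℕ} (hC : s.next ∉ C) (c : ℕ → ℚ) :
    ∑ y ∈ insert s.next (C.erase x), c y • qv (s.move m R).vec y =
      c s.next • (∑ r ∈ R, qv s.vec r) + ∑ y ∈ C.erase x, c y • qv s.vec y := by
  have h1 : s.next ∉ C.erase x := fun h => hC (Finset.mem_of_mem_erase h)
  rw [Finset.sum_insert h1, qv_move_next]
  congr 1
  exact Finset.sum_congr rfl (fun y hy => by rw [qv_move_of_ne (fun h => h1 (h ▸ hy))])

/-- **(B2-a) New cones lie inside their parents**: a point of the cone of a child `(C ∖ x) ∪ {ρ}` (`x ∈ R ⊆ C`) lies in the cone of `C`,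
with explicit coefficients `γ_x = α`, `γ_y = α·[y ∈ R] + β_y`. -/
theorem inCone_parent_of_inCone_child {m : ℕ} {s : VState ι} {R C : Finset ℕ} {x : ℕ} (hRC : R ⊆ C) (hx : x ∈ R) (hC : s.next ∉ C)
    {p : Fin 3 → ℚ} (hp : InCone (s.move m R).vec (insert s.next (C.erase x)) p) : InCone s.vec C p := by
  classical
  obtain ⟨c, hc0, hcp⟩ := hp
  have hxC : x ∈ C := hRC hx
  have h1 : s.next ∉ C.erase x := fun h => hC (Finset.mem_of_mem_erase h)
  have hα : 0 ≤ c s.next := hc0 _ (Finset.mem_insert_self _ _)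
  refine ⟨fun y => (if y = x then 0 else c y) + (if y ∈ R then c s.next else 0), fun y hy => ?_, ?_⟩
  · have : 0 ≤ (if y = x then 0 else c y) := by
      split_ifs with h
      · exact le_rfl
      · exact hc0 y (Finset.mem_insert_of_mem (Finset.mem_erase.mpr ⟨h, hy⟩))
    have : 0 ≤ (if y ∈ R then c s.next else 0) := by split_ifs <;> [exact hα; exact le_rfl]
    positivity
  · rw [hcp, sum_child_qv hC, add_comm]
    simp_rw [add_smul, Finset.sum_add_distrib]
    congr 1
    · -- Σ_{C∖x} c y • v y = Σ_C (if y = x then 0 else c y) • v y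
      rw [← Finset.add_sum_erase C (fun y => (if y = x then (0:ℚ) else c y) • qv s.vec y) hxC, if_pos rfl, zero_smul, zero_add]
      exact Finset.sum_congr rfl (fun y hy => by rw [if_neg (Finset.mem_erase.mp hy).1])
    · -- c ρ • Σ_R v = Σ_C (if y ∈ R then c ρ else 0) • v y
      rw [Finset.smul_sum,
        ← Finset.sum_subset hRC (f := fun y => (if y ∈ R then c s.next else 0) • qv s.vec y)
          (fun y _ hyR => by rw [if_neg hyR, zero_smul])]
      exact Finset.sum_congr rfl (fun y hy => by rw [if_pos hy])

/-- **(B2-b) Independence is preserved**: the child cone `(C ∖ x) ∪ {ρ}` of an independent cone `C ⊇ R ∋ x` is independent (unimodular base change). -/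
theorem indep_child {m : ℕ} {s : VState ι} {R C : Finset ℕ} {x : ℕ} (hind : Indep s.vec C) (hRC : R ⊆ C) (hx : x ∈ R)
    (hC : s.next ∉ C) : Indep (s.move m R).vec (insert s.next (C.erase x)) := by
  classical
  intro c hc y hy
  have hxC : x ∈ C := hRC hx
  have h1 : s.next ∉ C.erase x := fun h => hC (Finset.mem_of_mem_erase h)
  rw [sum_child_qv hC] at hc
  -- rewrite as a combination over C with coefficients γ
  set γ : ℕ → ℚ := fun y => (if y = x then 0 else c y) + (if y ∈ R then c s.next else 0) with hγ
  have hsum : ∑ y ∈ C, γ y • qv s.vec y = 0 := by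
    rw [← hc]
    simp_rw [hγ, add_smul, Finset.sum_add_distrib]
    rw [add_comm]
    congr 1
    · rw [Finset.smul_sum,
        ← Finset.sum_subset hRC (f := fun y => (if y ∈ R then c s.next else 0) • qv s.vec y)
          (fun y _ hyR => by rw [if_neg hyR, zero_smul])]
      exact Finset.sum_congr rfl (fun y hy => by rw [if_pos hy])
    · rw [← Finset.add_sum_erase C (fun y => (if y = x then (0:ℚ) else c y) • qv s.vec y) hxC, if_pos rfl, zero_smul, zero_add]
      exact Finset.sum_congr rfl (fun y hy => by rw [if_neg (Finset.mem_erase.mp hy).1])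
  have hγ0 := hind γ hsum
  -- γ_x = c ρ = 0
  have hρ : c s.next = 0 := by
    have := hγ0 x hxC
    simpa [hγ, hx] using this
  rcases Finset.mem_insert.mp hy with rfl | hy'
  · exact hρ
  · have hyx : y ≠ x := (Finset.mem_erase.mp hy').1
    have hyC : y ∈ C := (Finset.mem_erase.mp hy').2
    have := hγ0 y hyC
    simpa [hγ, hyx, hρ] using this

end VState

end Summit.ResolutionOfSingularities.ResolutionOfSingularities.Theorems.CampaignW42.Toric
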